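import Mathlib.Tactic.Ring
import Mathlib.Tactic.Linarith
import Mathlib.Tactic.Positivity
import Mathlib.Tactic.LinearCombination
import Mathlib.Tactic.FieldSimp
import Mathlib.Data.Real.Basic
import Mathlib.Analysis.Real.Sqrt
import Summits.HodgeConjecture.HodgeConjecture.Theorems.WeilClassTestFormatFourTwoLambda
import HarnessLib

/-!
# CROSS-MAX in format (4,2) — part 1/2: the equality case of the slope lemma and the vertex (hodge-weil ladder, GAPS G51b′)

Prover 2, generation 14, ADDENDUM 1 (note `run/shared/lean/b2b/hodge-weil/b2b-hweil-pv2-g14/THREE-PHASE-G14.md` §5 (iii) / ADDENDUM 1).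
By `conjectureN_42_sharp` every centred, pure, pairwise-ample real (4,2) configuration has `Q₂ + (3 + 2√3)·Q₄ ≥ 0`, and by
`conjectureN_42_sharp_attained` equality occurs. THEOREM (`crossMax_42`): EVERY configuration with equality and `Q₂ > 0` (i.e. every
maximiser of `−Q₄/Q₂`, value `2/√3 − 1`) is a CROSS (null-cone) configuration in the sense of `CONJECTURE-N.md` §3: all six roots are
null-separated from one vertex `(A₀, u₀)`, `(u_k − u₀)² = (A_k − A₀)²`. This is pv2-g9's CROSS-MAX CONJECTURE (G51b′) in format (4,2);
this file proves it in the one-sided sorted frame (`crossMax_42_onesided`), the companion `…CrossMax.lean` removes frame and sorting.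
Proof: in the equality case the slope lemma of `WeilClassTestFormatFourTwoSlopes` is tight (`slope_lemma_eq`): from the one-sided F-root
three inverse slopes are `1` (three E-roots on its null ray), from the other the two E-roots beyond it are on its null ray (`p₁ = p₂ = 1`)
and the remaining two have equal slope (`q₃ = q₄`), `e₁ = 2λ + 2`; `cross_of_equality` turns this into a vertex (the E-root on both null
lines), the sub-case 'the fourth E-root off both null lines' being excluded by `P < q < (2λ − 1)q < P` (`P = B₂ − B₁`, `q = v₂ − v₁`).
Pure algebra; nothing here is a case of HC, a rung or a door edge (C22); no statement of Markman's papers is used. New cell result ⇒ Summits/.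
-/

set_option linter.dupNamespace false

namespace Summit.HodgeConjecture.HodgeConjecture.WeilClassTestFormatFourTwoLambda

open Summit.HodgeConjecture.HodgeConjecture.WeilClassTestProductFormula
open Summit.HodgeConjecture.HodgeConjecture.WeilClassTestFormatFourTwo

set_option maxHeartbeats 400000 in
/-- EQUALITY CASE OF THE SLOPE LEMMA: if moreover `e₂(m) = 6λ` then `e₁(m) = 2λ + 2`, at least three `m_e = 1` (all pair products
`(m_i − 1)(m_j − 1)` vanish), `p₁ = p₂ = 1` and `q₃ = q₄`. -/
theorem slope_lemma_eq (m₁ m₂ m₃ m₄ p₁ p₂ q₃ q₄ l : ℝ) (h₁ : 1 ≤ m₁) (h₂ : 1 ≤ m₂) (h₃ : 1 ≤ m₃) (h₄ : 1 ≤ m₄)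
    (hp₁ : 1 ≤ p₁) (hp₂ : 1 ≤ p₂) (hq₃ : 1 ≤ q₃) (hq₄ : 1 ≤ q₄)
    (he₁ : m₁ + m₂ + m₃ + m₄ = q₃ + q₄ - p₁ - p₂)
    (he₂ : m₁ * m₂ + m₁ * m₃ + m₁ * m₄ + m₂ * m₃ + m₂ * m₄ + m₃ * m₄ = p₁ * p₂ - (p₁ + p₂) * (q₃ + q₄) + q₃ * q₄)
    (hl' : l ^ 2 ≤ 6 * l + 3) (heq : m₁ * m₂ + m₁ * m₃ + m₁ * m₄ + m₂ * m₃ + m₂ * m₄ + m₃ * m₄ = 6 * l) :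
    ((m₁ - 1) * (m₂ - 1) = 0 ∧ (m₁ - 1) * (m₃ - 1) = 0 ∧ (m₁ - 1) * (m₄ - 1) = 0 ∧ (m₂ - 1) * (m₃ - 1) = 0
      ∧ (m₂ - 1) * (m₄ - 1) = 0 ∧ (m₃ - 1) * (m₄ - 1) = 0)
    ∧ p₁ = 1 ∧ p₂ = 1 ∧ q₃ = q₄ ∧ m₁ + m₂ + m₃ + m₄ = 2 * l + 2 := by
  set S := m₁ + m₂ + m₃ + m₄ with hS
  have p₁₂ := mul_nonneg (sub_nonneg.2 h₁) (sub_nonneg.2 h₂)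
  have p₁₃ := mul_nonneg (sub_nonneg.2 h₁) (sub_nonneg.2 h₃)
  have p₁₄ := mul_nonneg (sub_nonneg.2 h₁) (sub_nonneg.2 h₄)
  have p₂₃ := mul_nonneg (sub_nonneg.2 h₂) (sub_nonneg.2 h₃)
  have p₂₄ := mul_nonneg (sub_nonneg.2 h₂) (sub_nonneg.2 h₄)
  have p₃₄ := mul_nonneg (sub_nonneg.2 h₃) (sub_nonneg.2 h₄)
  have esum : m₁ * m₂ + m₁ * m₃ + m₁ * m₄ + m₂ * m₃ + m₂ * m₄ + m₃ * m₄ - (3 * S - 6)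
      = (m₁ - 1) * (m₂ - 1) + (m₁ - 1) * (m₃ - 1) + (m₁ - 1) * (m₄ - 1) + (m₂ - 1) * (m₃ - 1)
        + (m₂ - 1) * (m₄ - 1) + (m₃ - 1) * (m₄ - 1) := by rw [hS]; ring
  have hlow : 3 * S - 6 ≤ m₁ * m₂ + m₁ * m₃ + m₁ * m₄ + m₂ * m₃ + m₂ * m₄ + m₃ * m₄ := by linarith [esum]
  have key' : (q₃ + q₄ - p₁ - p₂) ^ 2 / 4 - (q₃ + q₄ - p₁ - p₂) - 2 - (p₁ * p₂ - (p₁ + p₂) * (q₃ + q₄) + q₃ * q₄)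
      = (p₁ + p₂ - 2) * (q₃ + q₄ + 2) / 2 + (q₃ - q₄) ^ 2 / 4 + (p₁ - p₂) ^ 2 / 4 := by ring
  have hd1 : 0 ≤ (p₁ + p₂ - 2) * (q₃ + q₄ + 2) / 2 := by
    have := mul_nonneg (show 0 ≤ p₁ + p₂ - 2 by linarith) (show 0 ≤ q₃ + q₄ + 2 by linarith)
    linarith
  have hup : p₁ * p₂ - (p₁ + p₂) * (q₃ + q₄) + q₃ * q₄ ≤ (q₃ + q₄ - p₁ - p₂) ^ 2 / 4 - (q₃ + q₄ - p₁ - p₂) - 2 := by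
    linarith [key', hd1, sq_nonneg (q₃ - q₄), sq_nonneg (p₁ - p₂)]
  rw [← he₂, ← he₁] at hup
  have hST := slope_lemma m₁ m₂ m₃ m₄ p₁ p₂ q₃ q₄ l h₁ h₂ h₃ h₄ hp₁ hp₂ hq₃ hq₄ he₁ he₂ hl'
  -- equality: S = 2l + 2 and e₂ = 3S − 6
  have hS1 : S ≤ 2 * l + 2 := by linarith
  have hS4 : 4 ≤ S := by rw [hS]; linarith
  have hf : 0 ≤ S ^ 2 - 16 * S + 16 := by linarith [hlow, hup]
  have h12 : 12 < S := by
    by_contra h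
    push Not at h
    have e : (S - 4) * (S - 12) = (S ^ 2 - 16 * S + 16) + 32 := by ring
    have := mul_nonpos_iff.2 (Or.inl ⟨show 0 ≤ S - 4 by linarith, show S - 12 ≤ 0 by linarith⟩)
    linarith
  have hS2 : 2 * l + 2 ≤ S := by
    by_cases hc : S - 14 + 2 * l ≤ 0
    · linarith
    · push Not at hc
      have prod : 0 ≤ (S - 2 * l - 2) * (S - 14 + 2 * l) := by
        have e : (S - 2 * l - 2) * (S - 14 + 2 * l) = (S ^ 2 - 16 * S + 16) + (24 * l + 12 - 4 * l ^ 2) := by ring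
        rw [e]
        have : 0 ≤ 24 * l + 12 - 4 * l ^ 2 := by linarith
        linarith
      have := le_of_mul_le_mul_right (by linarith [prod] : 0 * (S - 14 + 2 * l) ≤ (S - 2 * l - 2) * (S - 14 + 2 * l)) hc
      linarith
  have hSeq : S = 2 * l + 2 := le_antisymm hS1 hS2
  have he2eq : m₁ * m₂ + m₁ * m₃ + m₁ * m₄ + m₂ * m₃ + m₂ * m₄ + m₃ * m₄ = 3 * S - 6 := by linarith
  have hsum0 : (m₁ - 1) * (m₂ - 1) + (m₁ - 1) * (m₃ - 1) + (m₁ - 1) * (m₄ - 1) + (m₂ - 1) * (m₃ - 1)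
        + (m₂ - 1) * (m₄ - 1) + (m₃ - 1) * (m₄ - 1) = 0 := by linarith [esum]
  -- the F₂ defect vanishes too: 3S − 6 = S²/4 − S − 2 at S = 2l+2 (l² = 6l+3 forced)
  have hdef : (p₁ + p₂ - 2) * (q₃ + q₄ + 2) / 2 + (q₃ - q₄) ^ 2 / 4 + (p₁ - p₂) ^ 2 / 4 ≤ 0 := by
    have e1 : S ^ 2 / 4 - S - 2 - (3 * S - 6) = l ^ 2 - 6 * l - 3 := by rw [hSeq]; ring
    have : (q₃ + q₄ - p₁ - p₂) ^ 2 / 4 - (q₃ + q₄ - p₁ - p₂) - 2 - (p₁ * p₂ - (p₁ + p₂) * (q₃ + q₄) + q₃ * q₄) ≤ 0 := by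
      rw [← he₂, ← he₁, he2eq]; linarith
    linarith [key']
  have sq1 := sq_nonneg (q₃ - q₄)
  have sq2 := sq_nonneg (p₁ - p₂)
  have hq : (q₃ - q₄) ^ 2 = 0 := by linarith
  have hp : (p₁ - p₂) ^ 2 = 0 := by linarith
  have hpq : (p₁ + p₂ - 2) * (q₃ + q₄ + 2) / 2 = 0 := by linarith
  have hq' : q₃ = q₄ := sub_eq_zero.1 ((pow_eq_zero_iff two_ne_zero).1 hq)
  have hp' : p₁ = p₂ := sub_eq_zero.1 ((pow_eq_zero_iff two_ne_zero).1 hp)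
  have hps : p₁ + p₂ = 2 := by
    have : (p₁ + p₂ - 2) * (q₃ + q₄ + 2) = 0 := by linarith
    rcases mul_eq_zero.1 this with h | h
    · linarith
    · linarith
  refine ⟨⟨?_, ?_, ?_, ?_, ?_, ?_⟩, by linarith, by linarith, hq', hSeq⟩
  · linarith
  · linarith
  · linarith
  · linarith
  · linarith
  · linarith

/-- EQUALITY CASE, denominators cleared (one-sided F-root `F₁`, pattern `F₁ E E F₂ E E`, `K₀ > 0`): if `12λ·K₀ = 2K₂` then at most one
E-root is off the upper null ray of `F₁` (`(a_i − b_i)(a_j − b_j) = 0` for all pairs), `E₁, E₂` are on the lower null ray of `F₂`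
(`a'_e = −b'_e`), `E₃, E₄` have slope `λ + 2` from `F₂`, and `K₁ = (2λ + 2)·K₀`. -/
theorem one_sided_core_eq (a₁ a₂ a₃ a₄ b₁ b₂ b₃ b₄ a₁' a₂' a₃' a₄' b₁' b₂' b₃' b₄' l : ℝ)
    (hb₁ : 0 < b₁) (hb₂ : 0 < b₂) (hb₃ : 0 < b₃) (hb₄ : 0 < b₄)
    (ha₁ : b₁ ≤ a₁) (ha₂ : b₂ ≤ a₂) (ha₃ : b₃ ≤ a₃) (ha₄ : b₄ ≤ a₄)
    (hb₁' : b₁' < 0) (hb₂' : b₂' < 0) (hb₃' : 0 < b₃') (hb₄' : 0 < b₄')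
    (ha₁' : -b₁' ≤ a₁') (ha₂' : -b₂' ≤ a₂') (ha₃' : b₃' ≤ a₃') (ha₄' : b₄' ≤ a₄')
    (hK0 : b₁ * b₂ * b₃ * b₄ = b₁' * b₂' * b₃' * b₄')
    (hK1 : a₁ * b₂ * b₃ * b₄ + a₂ * b₁ * b₃ * b₄ + a₃ * b₁ * b₂ * b₄ + a₄ * b₁ * b₂ * b₃
      = a₁' * b₂' * b₃' * b₄' + a₂' * b₁' * b₃' * b₄' + a₃' * b₁' * b₂' * b₄' + a₄' * b₁' * b₂' * b₃')
    (hK2 : a₁ * a₂ * b₃ * b₄ + a₁ * a₃ * b₂ * b₄ + a₁ * a₄ * b₂ * b₃ + a₂ * a₃ * b₁ * b₄ + a₂ * a₄ * b₁ * b₃ + a₃ * a₄ * b₁ * b₂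
      = a₁' * a₂' * b₃' * b₄' + a₁' * a₃' * b₂' * b₄' + a₁' * a₄' * b₂' * b₃' + a₂' * a₃' * b₁' * b₄' + a₂' * a₄' * b₁' * b₃' + a₃' * a₄' * b₁' * b₂')
    (hl' : l ^ 2 ≤ 6 * l + 3)
    (heq : 12 * l * (b₁ * b₂ * b₃ * b₄) = 2 * (a₁ * a₂ * b₃ * b₄ + a₁ * a₃ * b₂ * b₄ + a₁ * a₄ * b₂ * b₃ + a₂ * a₃ * b₁ * b₄ + a₂ * a₄ * b₁ * b₃ + a₃ * a₄ * b₁ * b₂)) :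
    ((a₁ - b₁) * (a₂ - b₂) = 0 ∧ (a₁ - b₁) * (a₃ - b₃) = 0 ∧ (a₁ - b₁) * (a₄ - b₄) = 0 ∧ (a₂ - b₂) * (a₃ - b₃) = 0 ∧ (a₂ - b₂) * (a₄ - b₄) = 0 ∧ (a₃ - b₃) * (a₄ - b₄) = 0)
    ∧ a₁' + b₁' = 0 ∧ a₂' + b₂' = 0 ∧ a₃' = (l + 2) * b₃' ∧ a₄' = (l + 2) * b₄'
    ∧ a₁ * b₂ * b₃ * b₄ + a₂ * b₁ * b₃ * b₄ + a₃ * b₁ * b₂ * b₄ + a₄ * b₁ * b₂ * b₃ = (2 * l + 2) * (b₁ * b₂ * b₃ * b₄) := by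
  obtain ⟨m₁, hm₁, rfl⟩ : ∃ m, 1 ≤ m ∧ a₁ = m * b₁ := ⟨a₁ / b₁, by rwa [le_div_iff₀ hb₁, one_mul], by field_simp⟩
  obtain ⟨m₂, hm₂, rfl⟩ : ∃ m, 1 ≤ m ∧ a₂ = m * b₂ := ⟨a₂ / b₂, by rwa [le_div_iff₀ hb₂, one_mul], by field_simp⟩
  obtain ⟨m₃, hm₃, rfl⟩ : ∃ m, 1 ≤ m ∧ a₃ = m * b₃ := ⟨a₃ / b₃, by rwa [le_div_iff₀ hb₃, one_mul], by field_simp⟩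
  obtain ⟨m₄, hm₄, rfl⟩ : ∃ m, 1 ≤ m ∧ a₄ = m * b₄ := ⟨a₄ / b₄, by rwa [le_div_iff₀ hb₄, one_mul], by field_simp⟩
  have nb₁ : 0 < -b₁' := by linarith
  have nb₂ : 0 < -b₂' := by linarith
  have ne₁ : b₁' ≠ 0 := hb₁'.ne
  have ne₂ : b₂' ≠ 0 := hb₂'.ne
  obtain ⟨p₁, hp₁, rfl⟩ : ∃ p, 1 ≤ p ∧ a₁' = p * (-b₁') :=
    ⟨a₁' / (-b₁'), by rwa [le_div_iff₀ nb₁, one_mul], by field_simp⟩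
  obtain ⟨p₂, hp₂, rfl⟩ : ∃ p, 1 ≤ p ∧ a₂' = p * (-b₂') :=
    ⟨a₂' / (-b₂'), by rwa [le_div_iff₀ nb₂, one_mul], by field_simp⟩
  obtain ⟨q₃, hq₃, rfl⟩ : ∃ q, 1 ≤ q ∧ a₃' = q * b₃' := ⟨a₃' / b₃', by rwa [le_div_iff₀ hb₃', one_mul], by field_simp⟩
  obtain ⟨q₄, hq₄, rfl⟩ : ∃ q, 1 ≤ q ∧ a₄' = q * b₄' := ⟨a₄' / b₄', by rwa [le_div_iff₀ hb₄', one_mul], by field_simp⟩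
  have hKpos : 0 < b₁ * b₂ * b₃ * b₄ := by positivity
  have e1 : (m₁ + m₂ + m₃ + m₄) * (b₁ * b₂ * b₃ * b₄) = (q₃ + q₄ - p₁ - p₂) * (b₁ * b₂ * b₃ * b₄) := by
    linear_combination hK1 - (q₃ + q₄ - p₁ - p₂) * hK0
  have e2 : (m₁ * m₂ + m₁ * m₃ + m₁ * m₄ + m₂ * m₃ + m₂ * m₄ + m₃ * m₄) * (b₁ * b₂ * b₃ * b₄)
      = (p₁ * p₂ - (p₁ + p₂) * (q₃ + q₄) + q₃ * q₄) * (b₁ * b₂ * b₃ * b₄) := by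
    linear_combination hK2 - (p₁ * p₂ - (p₁ + p₂) * (q₃ + q₄) + q₃ * q₄) * hK0
  have e3 : (m₁ * m₂ + m₁ * m₃ + m₁ * m₄ + m₂ * m₃ + m₂ * m₄ + m₃ * m₄) * (b₁ * b₂ * b₃ * b₄) = (6 * l) * (b₁ * b₂ * b₃ * b₄) := by
    linear_combination (-1 / 2 : ℝ) * heq
  have he₁ := mul_right_cancel₀ hKpos.ne' e1
  have he₂ := mul_right_cancel₀ hKpos.ne' e2
  have he₃ := mul_right_cancel₀ hKpos.ne' e3
  obtain ⟨⟨f₁₂, f₁₃, f₁₄, f₂₃, f₂₄, f₃₄⟩, gp₁, gp₂, gq, gS⟩ :=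
    slope_lemma_eq m₁ m₂ m₃ m₄ p₁ p₂ q₃ q₄ l hm₁ hm₂ hm₃ hm₄ hp₁ hp₂ hq₃ hq₄ he₁ he₂ hl' he₃
  refine ⟨⟨?_, ?_, ?_, ?_, ?_, ?_⟩, ?_, ?_, ?_, ?_, ?_⟩
  · linear_combination (b₁ * b₂) * f₁₂
  · linear_combination (b₁ * b₃) * f₁₃
  · linear_combination (b₁ * b₄) * f₁₄
  · linear_combination (b₂ * b₃) * f₂₃
  · linear_combination (b₂ * b₄) * f₂₄
  · linear_combination (b₃ * b₄) * f₃₄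
  · linear_combination (-b₁') * gp₁
  · linear_combination (-b₂') * gp₂
  · have : q₃ = l + 2 := by linarith
    rw [this]
  · have : q₄ = l + 2 := by linarith
    rw [this]
  · linear_combination (b₁ * b₂ * b₃ * b₄) * gS

/-- FROM THE EQUALITY CASE TO THE VERTEX (pattern frame: `v₁ < u_e`, `u₁, u₂ < v₂ < u₃, u₄`, `λ > 3`). At most one E-root off the upper
null ray of `F₁`, `E₁, E₂` on the lower null ray of `F₂`, `E₃, E₄` of slope `λ+2` from `F₂`, `K₁ = (2λ+2)K₀` ⇒ all six roots are
null-separated from the vertex `E₁` or `E₂` (the sub-cases 'E₃ or E₄ off the ray' force `B₂ − B₁ < v₂ − v₁ < B₂ − B₁`). -/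
theorem cross_of_equality (A₁ A₂ A₃ A₄ B₁ B₂ u₁ u₂ u₃ u₄ v₁ v₂ l : ℝ) (hl3 : 3 < l)
    (hb₁ : v₁ < u₁) (hb₂ : v₁ < u₂)
    (d₁ : u₁ < v₂) (d₃ : v₂ < u₃) (d₄ : v₂ < u₄)
    (E12 : ((A₁ - B₁) - (u₁ - v₁)) * ((A₂ - B₁) - (u₂ - v₁)) = 0) (E13 : ((A₁ - B₁) - (u₁ - v₁)) * ((A₃ - B₁) - (u₃ - v₁)) = 0)
    (E14 : ((A₁ - B₁) - (u₁ - v₁)) * ((A₄ - B₁) - (u₄ - v₁)) = 0) (E23 : ((A₂ - B₁) - (u₂ - v₁)) * ((A₃ - B₁) - (u₃ - v₁)) = 0)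
    (E24 : ((A₂ - B₁) - (u₂ - v₁)) * ((A₄ - B₁) - (u₄ - v₁)) = 0) (E34 : ((A₃ - B₁) - (u₃ - v₁)) * ((A₄ - B₁) - (u₄ - v₁)) = 0)
    (F1 : (A₁ - B₂) + (u₁ - v₂) = 0) (F2 : (A₂ - B₂) + (u₂ - v₂) = 0)
    (G3 : (A₃ - B₂) = (l + 2) * (u₃ - v₂)) (G4 : (A₄ - B₂) = (l + 2) * (u₄ - v₂))
    (HK : (A₁ - B₁) * (u₂ - v₁) * (u₃ - v₁) * (u₄ - v₁) + (A₂ - B₁) * (u₁ - v₁) * (u₃ - v₁) * (u₄ - v₁) + (A₃ - B₁) * (u₁ - v₁) * (u₂ - v₁) * (u₄ - v₁) + (A₄ - B₁) * (u₁ - v₁) * (u₂ - v₁) * (u₃ - v₁) = (2 * l + 2) * ((u₁ - v₁) * (u₂ - v₁) * (u₃ - v₁) * (u₄ - v₁))) :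
    ∃ A₀ u₀ : ℝ, (u₁ - u₀) ^ 2 = (A₁ - A₀) ^ 2 ∧ (u₂ - u₀) ^ 2 = (A₂ - A₀) ^ 2 ∧ (u₃ - u₀) ^ 2 = (A₃ - A₀) ^ 2 ∧ (u₄ - u₀) ^ 2 = (A₄ - A₀) ^ 2 ∧ (v₁ - u₀) ^ 2 = (B₁ - A₀) ^ 2 ∧ (v₂ - u₀) ^ 2 = (B₂ - A₀) ^ 2 := by
  by_cases h1 : (A₁ - B₁) - (u₁ - v₁) = 0
  · by_cases h4 : (A₄ - B₁) - (u₄ - v₁) = 0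
    · by_cases h3 : (A₃ - B₁) - (u₃ - v₁) = 0
      · -- E₁, E₃, E₄ on the upper null ray of F₁; E₂ on the lower null ray of F₂ through E₁: vertex E₁
        refine ⟨A₁, u₁, by ring, ?_, ?_, ?_, ?_, ?_⟩
        · have e : A₂ - A₁ = -(u₂ - u₁) := by linarith
          rw [e]; ring
        · have e : A₃ - A₁ = u₃ - u₁ := by linarith
          rw [e]
        · have e : A₄ - A₁ = u₄ - u₁ := by linarith
          rw [e]
        · have e : B₁ - A₁ = v₁ - u₁ := by linarith
          rw [e]
        · have e : B₂ - A₁ = -(v₂ - u₁) := by linarith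
          rw [e]; ring
      · -- E₃ off: then E₂ on (E23), and K₁ = (2l+2)K₀ gives a₃ = (2l−1)b₃; with G3 and F1: contradiction
        have h2 : (A₂ - B₁) - (u₂ - v₁) = 0 := (mul_eq_zero.1 E23).resolve_right h3
        have key : ((A₃ - B₁) - (2 * l - 1) * (u₃ - v₁)) * ((u₁ - v₁) * (u₂ - v₁) * (u₄ - v₁)) = 0 := by
          linear_combination HK - ((u₂ - v₁) * (u₃ - v₁) * (u₄ - v₁)) * h1 - ((u₁ - v₁) * (u₃ - v₁) * (u₄ - v₁)) * h2
            - ((u₁ - v₁) * (u₂ - v₁) * (u₃ - v₁)) * h4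
        have hprod : 0 < (u₁ - v₁) * (u₂ - v₁) * (u₄ - v₁) := mul_pos (mul_pos (by linarith) (by linarith)) (by linarith)
        have ha3 : (A₃ - B₁) - (2 * l - 1) * (u₃ - v₁) = 0 := (mul_eq_zero.1 key).resolve_right hprod.ne'
        -- P := B₂ − B₁, q := v₂ − v₁:  (l − 3)·b₃ = P − (l+2)·q  and  P = 2b₁ − q
        have hP1 : (B₂ - B₁) = 2 * (u₁ - v₁) - (v₂ - v₁) := by linarith
        have hP2 : (l - 3) * (u₃ - v₁) = (B₂ - B₁) - (l + 2) * (v₂ - v₁) := by linarith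
        have : 0 < (l - 3) * (u₃ - v₁) := mul_pos (by linarith) (by linarith)
        have : 0 < (l + 2) * (v₂ - v₁) - (v₂ - v₁) := by
          have := mul_pos (show 0 < l + 1 by linarith) (show 0 < v₂ - v₁ by linarith)
          linarith
        exfalso
        linarith
    · -- E₄ off: then E₂, E₃ on (E24, E34); a₄ = (2l−1)b₄; with G4 and F1: contradiction
      have h2 : (A₂ - B₁) - (u₂ - v₁) = 0 := (mul_eq_zero.1 E24).resolve_right h4
      have h3 : (A₃ - B₁) - (u₃ - v₁) = 0 := (mul_eq_zero.1 E34).resolve_right h4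
      have key : ((A₄ - B₁) - (2 * l - 1) * (u₄ - v₁)) * ((u₁ - v₁) * (u₂ - v₁) * (u₃ - v₁)) = 0 := by
        linear_combination HK - ((u₂ - v₁) * (u₃ - v₁) * (u₄ - v₁)) * h1 - ((u₁ - v₁) * (u₃ - v₁) * (u₄ - v₁)) * h2
          - ((u₁ - v₁) * (u₂ - v₁) * (u₄ - v₁)) * h3
      have hprod : 0 < (u₁ - v₁) * (u₂ - v₁) * (u₃ - v₁) := mul_pos (mul_pos (by linarith) (by linarith)) (by linarith)
      have ha4 : (A₄ - B₁) - (2 * l - 1) * (u₄ - v₁) = 0 := (mul_eq_zero.1 key).resolve_right hprod.ne'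
      have hP1 : (B₂ - B₁) = 2 * (u₁ - v₁) - (v₂ - v₁) := by linarith
      have hP2 : (l - 3) * (u₄ - v₁) = (B₂ - B₁) - (l + 2) * (v₂ - v₁) := by linarith
      have : 0 < (l - 3) * (u₄ - v₁) := mul_pos (by linarith) (by linarith)
      have : 0 < (l + 2) * (v₂ - v₁) - (v₂ - v₁) := by
        have := mul_pos (show 0 < l + 1 by linarith) (show 0 < v₂ - v₁ by linarith)
        linarith
      exfalso
      linarith
  · -- E₁ off the upper null ray of F₁: then E₂, E₃, E₄ are on it; vertex E₂
    have h2 : (A₂ - B₁) - (u₂ - v₁) = 0 := (mul_eq_zero.1 E12).resolve_left h1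
    have h3 : (A₃ - B₁) - (u₃ - v₁) = 0 := (mul_eq_zero.1 E13).resolve_left h1
    have h4 : (A₄ - B₁) - (u₄ - v₁) = 0 := (mul_eq_zero.1 E14).resolve_left h1
    refine ⟨A₂, u₂, ?_, by ring, ?_, ?_, ?_, ?_⟩
    · have e : A₁ - A₂ = -(u₁ - u₂) := by linarith
      rw [e]; ring
    · have e : A₃ - A₂ = u₃ - u₂ := by linarith
      rw [e]
    · have e : A₄ - A₂ = u₄ - u₂ := by linarith
      rw [e]
    · have e : B₁ - A₂ = v₁ - u₂ := by linarith
      rw [e]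
    · have e : B₂ - A₂ = -(v₂ - u₂) := by linarith
      rw [e]; ring

/-- `(3 + 2√3)² = 6(3 + 2√3) + 3` and `3 < 3 + 2√3`. -/
theorem sharp_const_facts : (3 + 2 * Real.sqrt 3) ^ 2 = 6 * (3 + 2 * Real.sqrt 3) + 3 ∧ (3 : ℝ) < (3 + 2 * Real.sqrt 3) := by
  have h3 : Real.sqrt 3 ^ 2 = 3 := Real.sq_sqrt (by norm_num)
  have hs : 0 < Real.sqrt 3 := Real.sqrt_pos.2 (by norm_num)
  exact ⟨by linear_combination 4 * h3, by linarith⟩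

set_option maxHeartbeats 800000 in
/-- CROSS-MAX, ONE-SIDED SORTED FRAME: `u₁ ≤ u₂ ≤ u₃ ≤ u₄`, `v₁ ≤ v₂`, `v₁ ≤ u₁`; equality `Q₂ + (3+2√3)Q₄ = 0` with `Q₂ > 0` ⇒ cross. -/
theorem crossMax_42_onesided (A₁ A₂ A₃ A₄ B₁ B₂ u₁ u₂ u₃ u₄ v₁ v₂ : ℝ)
    (hA : A₁ + A₂ + A₃ + A₄ = B₁ + B₂) (hC : u₁ + u₂ + u₃ + u₄ = v₁ + v₂)
    (hP1 : (A₁ ^ 2 * u₁ + A₂ ^ 2 * u₂ + A₃ ^ 2 * u₃ + A₄ ^ 2 * u₄) - (B₁ ^ 2 * v₁ + B₂ ^ 2 * v₂) = 0)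
    (hP2 : (A₁ * u₁ ^ 2 + A₂ * u₂ ^ 2 + A₃ * u₃ ^ 2 + A₄ * u₄ ^ 2) - (B₁ * v₁ ^ 2 + B₂ * v₂ ^ 2) = 0)
    (hP4 : (u₁ ^ 3 + u₂ ^ 3 + u₃ ^ 3 + u₄ ^ 3) - (v₁ ^ 3 + v₂ ^ 3) = 0)
    (m₁₁ : |u₁ - v₁| ≤ A₁ - B₁) (m₂₁ : |u₂ - v₁| ≤ A₂ - B₁) (m₃₁ : |u₃ - v₁| ≤ A₃ - B₁) (m₄₁ : |u₄ - v₁| ≤ A₄ - B₁)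
    (m₁₂ : |u₁ - v₂| ≤ A₁ - B₂) (m₂₂ : |u₂ - v₂| ≤ A₂ - B₂) (m₃₂ : |u₃ - v₂| ≤ A₃ - B₂) (m₄₂ : |u₄ - v₂| ≤ A₄ - B₂)
    (o₁₂ : u₁ ≤ u₂) (o₂₃ : u₂ ≤ u₃) (o₃₄ : u₃ ≤ u₄) (ov : v₁ ≤ v₂) (s₁ : v₁ ≤ u₁)
    (hQ : (1 / 2) * ((A₁ ^ 2 + A₂ ^ 2 + A₃ ^ 2 + A₄ ^ 2) - (B₁ ^ 2 + B₂ ^ 2)) * ((u₁ ^ 2 + u₂ ^ 2 + u₃ ^ 2 + u₄ ^ 2) - (v₁ ^ 2 + v₂ ^ 2))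
        + ((A₁ * u₁ + A₂ * u₂ + A₃ * u₃ + A₄ * u₄) - (B₁ * v₁ + B₂ * v₂)) ^ 2
        - 3 * ((A₁ ^ 2 * u₁ ^ 2 + A₂ ^ 2 * u₂ ^ 2 + A₃ ^ 2 * u₃ ^ 2 + A₄ ^ 2 * u₄ ^ 2) - (B₁ ^ 2 * v₁ ^ 2 + B₂ ^ 2 * v₂ ^ 2))
      + (3 + 2 * Real.sqrt 3) * (3 * ((u₁ ^ 4 + u₂ ^ 4 + u₃ ^ 4 + u₄ ^ 4) - (v₁ ^ 4 + v₂ ^ 4)) - (3 / 2) * ((u₁ ^ 2 + u₂ ^ 2 + u₃ ^ 2 + u₄ ^ 2) - (v₁ ^ 2 + v₂ ^ 2)) ^ 2) = 0)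
    (hpos : 0 < (1 / 2) * ((A₁ ^ 2 + A₂ ^ 2 + A₃ ^ 2 + A₄ ^ 2) - (B₁ ^ 2 + B₂ ^ 2)) * ((u₁ ^ 2 + u₂ ^ 2 + u₃ ^ 2 + u₄ ^ 2) - (v₁ ^ 2 + v₂ ^ 2))
        + ((A₁ * u₁ + A₂ * u₂ + A₃ * u₃ + A₄ * u₄) - (B₁ * v₁ + B₂ * v₂)) ^ 2
        - 3 * ((A₁ ^ 2 * u₁ ^ 2 + A₂ ^ 2 * u₂ ^ 2 + A₃ ^ 2 * u₃ ^ 2 + A₄ ^ 2 * u₄ ^ 2) - (B₁ ^ 2 * v₁ ^ 2 + B₂ ^ 2 * v₂ ^ 2)))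
    :
    ∃ A₀ u₀ : ℝ, (u₁ - u₀) ^ 2 = (A₁ - A₀) ^ 2 ∧ (u₂ - u₀) ^ 2 = (A₂ - A₀) ^ 2 ∧ (u₃ - u₀) ^ 2 = (A₃ - A₀) ^ 2 ∧ (u₄ - u₀) ^ 2 = (A₄ - A₀) ^ 2 ∧ (v₁ - u₀) ^ 2 = (B₁ - A₀) ^ 2 ∧ (v₂ - u₀) ^ 2 = (B₂ - A₀) ^ 2 := by
  obtain ⟨hL2, hL3⟩ := sharp_const_facts
  have hL' : (3 + 2 * Real.sqrt 3) ^ 2 ≤ 6 * (3 + 2 * Real.sqrt 3) + 3 := hL2.le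
  have hQ2 := Q2_eq_F1 A₁ A₂ A₃ A₄ B₁ B₂ u₁ u₂ u₃ u₄ v₁ v₂ hA hC
  have hQ4 := Q4_eq_F1 u₁ u₂ u₃ u₄ v₁ v₂ hC
  rw [hP1, hP2] at hQ2
  rw [hP4] at hQ4
  have hK0 := K0_F1_sub_K0_F2 u₁ u₂ u₃ u₄ v₁ v₂ hC
  rw [hP4, mul_zero] at hK0
  by_cases hz : (u₁ - v₁) * (u₂ - v₁) * (u₃ - v₁) * (u₄ - v₁) = 0
  · exfalso
    have hq4 : 3 * ((u₁ ^ 4 + u₂ ^ 4 + u₃ ^ 4 + u₄ ^ 4) - (v₁ ^ 4 + v₂ ^ 4)) - (3 / 2) * ((u₁ ^ 2 + u₂ ^ 2 + u₃ ^ 2 + u₄ ^ 2) - (v₁ ^ 2 + v₂ ^ 2)) ^ 2 = 0 := by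
      rw [hQ4, hz]; ring
    rw [hq4, mul_zero, add_zero] at hQ
    linarith
  · have hb₁ : 0 < u₁ - v₁ := by
      rcases (sub_nonneg.2 s₁).eq_or_lt with h | h
      · exact absurd (by rw [← h]; ring) hz
      · exact h
    have hb₂ : 0 < u₂ - v₁ := by linarith
    have hb₃ : 0 < u₃ - v₁ := by linarith
    have hb₄ : 0 < u₄ - v₁ := by linarith
    have hKpos : 0 < (u₁ - v₁) * (u₂ - v₁) * (u₃ - v₁) * (u₄ - v₁) := mul_pos (mul_pos (mul_pos hb₁ hb₂) hb₃) hb₄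
    have hK0' : (u₁ - v₂) * (u₂ - v₂) * (u₃ - v₂) * (u₄ - v₂) = (u₁ - v₁) * (u₂ - v₁) * (u₃ - v₁) * (u₄ - v₁) := by linarith
    have nz : (u₁ - v₂) * (u₂ - v₂) * (u₃ - v₂) * (u₄ - v₂) ≠ 0 := by rw [hK0']; exact ne_of_gt hKpos
    have ne₁ : v₂ ≠ u₁ := fun h => nz (by rw [h]; ring)
    have ne₂ : v₂ ≠ u₂ := fun h => nz (by rw [h]; ring)
    have ne₃ : v₂ ≠ u₃ := fun h => nz (by rw [h]; ring)
    have ne₄ : v₂ ≠ u₄ := fun h => nz (by rw [h]; ring)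
    by_cases c1 : v₂ < u₁
    · exact (both_below_impossible u₁ u₂ u₃ u₄ v₁ v₂ hC hP4 ov c1 (by linarith) (by linarith) (by linarith)).elim
    have d₁ : u₁ < v₂ := lt_of_le_of_ne (not_lt.1 c1) (Ne.symm ne₁)
    by_cases c2 : v₂ < u₂
    · have : (u₁ - v₂) * (u₂ - v₂) * (u₃ - v₂) * (u₄ - v₂) < 0 := by
        have t : 0 < (u₂ - v₂) * (u₃ - v₂) * (u₄ - v₂) := by
          have := mul_pos (show 0 < u₂ - v₂ by linarith) (show 0 < u₃ - v₂ by linarith)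
          exact mul_pos this (by linarith)
        have e : (u₁ - v₂) * (u₂ - v₂) * (u₃ - v₂) * (u₄ - v₂) = (u₁ - v₂) * ((u₂ - v₂) * (u₃ - v₂) * (u₄ - v₂)) := by ring
        rw [e]; exact mul_neg_of_neg_of_pos (by linarith) t
      linarith
    have d₂ : u₂ < v₂ := lt_of_le_of_ne (not_lt.1 c2) (Ne.symm ne₂)
    by_cases c3 : v₂ < u₃
    · -- THE PATTERN F₁ E E F₂ E E: equality case of the slope lemma, then the vertex
      have hK1 := K1_F1_sub_K1_F2 A₁ A₂ A₃ A₄ B₁ B₂ u₁ u₂ u₃ u₄ v₁ v₂ hA hC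
      rw [hP2, hP4, mul_zero, mul_zero, add_zero] at hK1
      have hK2 := K2_F1_sub_K2_F2 A₁ A₂ A₃ A₄ B₁ B₂ u₁ u₂ u₃ u₄ v₁ v₂ hA hC
      rw [hP1, hP2, mul_zero, mul_zero, add_zero] at hK2
      have heq : 12 * (3 + 2 * Real.sqrt 3) * ((u₁ - v₁) * (u₂ - v₁) * (u₃ - v₁) * (u₄ - v₁)) = 2 * ((A₁ - B₁) * (A₂ - B₁) * (u₃ - v₁) * (u₄ - v₁)
          + (A₁ - B₁) * (A₃ - B₁) * (u₂ - v₁) * (u₄ - v₁)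
          + (A₁ - B₁) * (A₄ - B₁) * (u₂ - v₁) * (u₃ - v₁)
          + (A₂ - B₁) * (A₃ - B₁) * (u₁ - v₁) * (u₄ - v₁)
          + (A₂ - B₁) * (A₄ - B₁) * (u₁ - v₁) * (u₃ - v₁)
          + (A₃ - B₁) * (A₄ - B₁) * (u₁ - v₁) * (u₂ - v₁)) := by
        rw [hQ2, hQ4] at hQ
        linarith
      obtain ⟨⟨E12, E13, E14, E23, E24, E34⟩, F1, F2, G3, G4, HK⟩ :=
        one_sided_core_eq (A₁ - B₁) (A₂ - B₁) (A₃ - B₁) (A₄ - B₁) (u₁ - v₁) (u₂ - v₁) (u₃ - v₁) (u₄ - v₁)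
        (A₁ - B₂) (A₂ - B₂) (A₃ - B₂) (A₄ - B₂) (u₁ - v₂) (u₂ - v₂) (u₃ - v₂) (u₄ - v₂) (3 + 2 * Real.sqrt 3)
        hb₁ hb₂ hb₃ hb₄
        (le_trans (le_abs_self _) m₁₁) (le_trans (le_abs_self _) m₂₁) (le_trans (le_abs_self _) m₃₁) (le_trans (le_abs_self _) m₄₁)
        (by linarith) (by linarith) (by linarith) (by linarith)
        (le_trans (neg_le_abs _) m₁₂) (le_trans (neg_le_abs _) m₂₂) (le_trans (le_abs_self _) m₃₂) (le_trans (le_abs_self _) m₄₂)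
        hK0'.symm (by linarith) (by linarith) hL' heq
      exact cross_of_equality A₁ A₂ A₃ A₄ B₁ B₂ u₁ u₂ u₃ u₄ v₁ v₂ (3 + 2 * Real.sqrt 3) hL3 (by linarith) (by linarith) d₁ c3 (by linarith)
        E12 E13 E14 E23 E24 E34 F1 F2 G3 G4 HK
    have d₃ : u₃ < v₂ := lt_of_le_of_ne (not_lt.1 c3) (Ne.symm ne₃)
    by_cases c4 : v₂ < u₄
    · have : (u₁ - v₂) * (u₂ - v₂) * (u₃ - v₂) * (u₄ - v₂) < 0 := by
        have t : 0 < (u₁ - v₂) * (u₂ - v₂) * (u₄ - v₂) := by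
          have := mul_pos_of_neg_of_neg (show u₁ - v₂ < 0 by linarith) (show u₂ - v₂ < 0 by linarith)
          exact mul_pos this (by linarith)
        have e : (u₁ - v₂) * (u₂ - v₂) * (u₃ - v₂) * (u₄ - v₂) = (u₃ - v₂) * ((u₁ - v₂) * (u₂ - v₂) * (u₄ - v₂)) := by ring
        rw [e]; exact mul_neg_of_neg_of_pos (by linarith) t
      linarith
    have d₄ : u₄ < v₂ := lt_of_le_of_ne (not_lt.1 c4) (Ne.symm ne₄)
    exact (below_above_impossible A₁ A₂ A₃ A₄ B₁ B₂ u₁ u₂ u₃ u₄ v₁ v₂ hA hC hP2 hP4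
      m₁₁ m₂₁ m₃₁ m₄₁ m₁₂ m₂₂ m₃₂ m₄₂ (by linarith) (by linarith) (by linarith) (by linarith) d₁ d₂ d₃ d₄).elim

end Summit.HodgeConjecture.HodgeConjecture.WeilClassTestFormatFourTwoLambda
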